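/-
Origin: expansion seat `planner-pub-hodgecm-pv15-g2-0`, handover #4 2026-08-18T06:42:04Z (`HOME/pub-hodgecm-pv15-g2/lean/Pv15g2/KernelPeriod.lean`, md5 8c6fe1c4, 160 lines);
landed by the gen-7 packager in gate run 25 as `HodgeCM/Automorphic/KernelPeriod.lean` (verbatim).
-/
/-
Origin: HOME/pub-hodgecm-pv15-g2/lean/Pv15g2/KernelPeriod.lean — session planner-pub-hodgecm-pv15-g2-0
(unit pub-hodgecm-pv15-g2, DAG-NODE PROVER #15 gen 2; lineage N23a).
Intended final place (packager's call): `HodgeCM/Automorphic/KernelPeriod.lean`.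
NEW, ADDITIVE; imports `Mathlib` only.  KIND: KERNEL, Mathlib generality — nothing cited, nothing posited.
(The theta-kernel OPERATOR `𝒯_Φ` itself is node N21, LANDED as `HodgeCM.PerL34.KernelOperator.opTC` (pv05, run 19) and is
re-used downstream, not re-proved here.)
-/
import Mathlib

/-!
# Weighted periods of continuous kernels on compact spaces, and translated kernel families

For compact spaces `X`, `Q` and a continuous kernel `K ∈ C(X × Q, ℂ)`:

* `sliceQ K : C(Q, C(X, ℂ))`, `sliceQ K q = K(·, q)`;
* `period ν w pt K : C(X, ℂ) := ∫ w(t) • K(·, pt t) dν(t)` (a `C(X, ℂ)`-valued Bochner integral) with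
  `period_apply : period ν w pt K x = ∫ w t * K (x, pt t) dν` — the model of `ϑ_{T,χ}(Φ)(g) = ∫_{[T]} θ_Φ(g, t) χ(t) dt`;
  `periodCLM` : it is a bounded linear operator in `K`, hence continuous (`continuous_period`);
* `translFamily K : C(G, C(X × Q, ℂ))`, `h ↦ K(·, h⁻¹ • ·)` for a continuous action of a topological group `G` on `Q`
  (currying; no countability hypothesis) — the model of `h ↦ θ_{ω(h)Φ}`.
-/

set_option autoImplicit false

noncomputable section

open MeasureTheory Set Filter Function
open scoped ENNReal

namespace HodgeCM
namespace KernelOp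

section Slice

variable {X Q : Type*} [TopologicalSpace X] [TopologicalSpace Q]

/-- The slices `q ↦ K(·, q)` of a kernel, as a continuous map `Q → C(X, ℂ)`. -/
def sliceQ (K : C(X × Q, ℂ)) : C(Q, C(X, ℂ)) := (K.comp ContinuousMap.prodSwap).curry

/-- (Ported verbatim from the HodgeCMPerL package; no docstring in the source.) -/
@[simp] theorem sliceQ_apply (K : C(X × Q, ℂ)) (q : Q) (x : X) : sliceQ K q x = K (x, q) := rfl

/-- (Ported verbatim from the HodgeCMPerL package; no docstring in the source.) -/
theorem sliceQ_add (K K' : C(X × Q, ℂ)) : sliceQ (K + K') = sliceQ K + sliceQ K' := by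
  ext q x; rfl

/-- (Ported verbatim from the HodgeCMPerL package; no docstring in the source.) -/
theorem sliceQ_smul (c : ℂ) (K : C(X × Q, ℂ)) : sliceQ (c • K) = c • sliceQ K := by
  ext q x; rfl

variable [CompactSpace X] [CompactSpace Q]

/-- (Ported verbatim from the HodgeCMPerL package; no docstring in the source.) -/
theorem norm_sliceQ_apply_le (K : C(X × Q, ℂ)) (q : Q) : ‖sliceQ K q‖ ≤ ‖K‖ := by
  refine (ContinuousMap.norm_le _ (norm_nonneg _)).mpr fun x => ?_
  rw [sliceQ_apply]
  exact K.norm_coe_le_norm (x, q)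

end Slice

/-! ## The period operator `K ↦ ∫ w(t) • K(·, pt t) dν(t)` -/

section Period

variable {X Q : Type*} [TopologicalSpace X] [CompactSpace X] [TopologicalSpace Q]
  {T : Type*} [MeasurableSpace T] (ν : Measure T)

/-- `period ν w pt K := ∫ w(t) • K(·, pt t) dν(t) ∈ C(X, ℂ)` (a Bochner integral in the Banach space `C(X, ℂ)`). -/
def period (w : T → ℂ) (pt : T → Q) (K : C(X × Q, ℂ)) : C(X, ℂ) := ∫ t, w t • sliceQ K (pt t) ∂ν

/-- (Ported verbatim from the HodgeCMPerL package; no docstring in the source.) -/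
theorem period_def (w : T → ℂ) (pt : T → Q) (K : C(X × Q, ℂ)) :
    period ν w pt K = ∫ t, w t • sliceQ K (pt t) ∂ν := rfl

/-- Pointwise evaluation of the period (evaluation is a continuous linear functional on `C(X, ℂ)`). -/
theorem period_apply (w : T → ℂ) (pt : T → Q) (K : C(X × Q, ℂ))
    (hint : Integrable (fun t => w t • sliceQ K (pt t)) ν) (x : X) :
    period ν w pt K x = ∫ t, w t * K (x, pt t) ∂ν := by
  have h := (ContinuousMap.evalCLM ℂ x : C(X, ℂ) →L[ℂ] ℂ).integral_comp_comm hint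
  simp only [ContinuousMap.evalCLM_apply, ContinuousMap.smul_apply, sliceQ_apply, smul_eq_mul] at h
  rw [period_def, ← h]

variable [TopologicalSpace T] [OpensMeasurableSpace T] [IsFiniteMeasureOnCompacts ν]

/-- For `w` continuous with compact support and `pt` continuous the integrand is integrable. -/
theorem integrable_smul_sliceQ {w : T → ℂ} (hw : Continuous w) (hws : HasCompactSupport w)
    {pt : T → Q} (hpt : Continuous pt) (K : C(X × Q, ℂ)) :
    Integrable (fun t => w t • sliceQ K (pt t)) ν :=
  (hw.smul ((sliceQ K).continuous.comp hpt)).integrable_of_hasCompactSupport hws.smul_right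

/-- (Ported verbatim from the HodgeCMPerL package; no docstring in the source.) -/
theorem period_apply' {w : T → ℂ} (hw : Continuous w) (hws : HasCompactSupport w)
    {pt : T → Q} (hpt : Continuous pt) (K : C(X × Q, ℂ)) (x : X) :
    period ν w pt K x = ∫ t, w t * K (x, pt t) ∂ν :=
  period_apply ν w pt K (integrable_smul_sliceQ ν hw hws hpt K) x

/-- (Ported verbatim from the HodgeCMPerL package; no docstring in the source.) -/
theorem period_add {w : T → ℂ} (hw : Continuous w) (hws : HasCompactSupport w)
    {pt : T → Q} (hpt : Continuous pt) (K K' : C(X × Q, ℂ)) :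
    period ν w pt (K + K') = period ν w pt K + period ν w pt K' := by
  rw [period_def, period_def, period_def,
    ← integral_add (integrable_smul_sliceQ ν hw hws hpt K) (integrable_smul_sliceQ ν hw hws hpt K')]
  refine integral_congr_ae (Eventually.of_forall fun t => ?_)
  simp only [sliceQ_add, ContinuousMap.add_apply, smul_add]

omit [TopologicalSpace T] [OpensMeasurableSpace T] [IsFiniteMeasureOnCompacts ν] in
/-- (Ported verbatim from the HodgeCMPerL package; no docstring in the source.) -/
theorem period_smul {w : T → ℂ} {pt : T → Q} (c : ℂ) (K : C(X × Q, ℂ)) :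
    period ν w pt (c • K) = c • period ν w pt K := by
  rw [period_def, period_def, ← integral_smul]
  refine integral_congr_ae (Eventually.of_forall fun t => ?_)
  simp only [sliceQ_smul, ContinuousMap.smul_apply, smul_comm c (w t)]

variable [CompactSpace Q]

/-- (Ported verbatim from the HodgeCMPerL package; no docstring in the source.) -/
theorem norm_period_le {w : T → ℂ} (hw : Continuous w) (hws : HasCompactSupport w)
    (pt : T → Q) (K : C(X × Q, ℂ)) :
    ‖period ν w pt K‖ ≤ (∫ t, ‖w t‖ ∂ν) * ‖K‖ := by
  rw [period_def, ← integral_mul_const]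
  refine norm_integral_le_of_norm_le
    ((hw.norm.integrable_of_hasCompactSupport hws.norm).mul_const _) (Eventually.of_forall fun t => ?_)
  rw [norm_smul]
  exact mul_le_mul_of_nonneg_left (norm_sliceQ_apply_le K (pt t)) (norm_nonneg _)

/-- **The period as a bounded linear operator in the kernel.** -/
def periodCLM {w : T → ℂ} (hw : Continuous w) (hws : HasCompactSupport w) {pt : T → Q} (hpt : Continuous pt) :
    C(X × Q, ℂ) →L[ℂ] C(X, ℂ) :=
  LinearMap.mkContinuous
    { toFun := period ν w pt
      map_add' := period_add ν hw hws hpt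
      map_smul' := period_smul ν }
    (∫ t, ‖w t‖ ∂ν) (norm_period_le ν hw hws pt)

/-- (Ported verbatim from the HodgeCMPerL package; no docstring in the source.) -/
@[simp] theorem periodCLM_apply {w : T → ℂ} (hw : Continuous w) (hws : HasCompactSupport w) {pt : T → Q}
    (hpt : Continuous pt) (K : C(X × Q, ℂ)) : periodCLM ν hw hws hpt K = period ν w pt K := rfl

/-- (Ported verbatim from the HodgeCMPerL package; no docstring in the source.) -/
theorem continuous_period {w : T → ℂ} (hw : Continuous w) (hws : HasCompactSupport w) {pt : T → Q}
    (hpt : Continuous pt) : Continuous (period ν w pt : C(X × Q, ℂ) → C(X, ℂ)) :=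
  (periodCLM ν hw hws hpt).continuous

end Period

/-! ## Translating the second variable of a kernel by a continuous action -/

section Transl

variable {X Q : Type*} [TopologicalSpace X] [TopologicalSpace Q]
  {G : Type*} [TopologicalSpace G] [Group G] [ContinuousInv G] [MulAction G Q] [ContinuousSMul G Q]

/-- **The translates `h ↦ K(·, h⁻¹ • ·)` of a kernel as a CONTINUOUS family `G → C(X × Q, ℂ)`** (compact-open
topology; on compact `X × Q` this is the sup-norm topology).  Continuity in `h` is the currying of the jointly
continuous map `(h, ξ, q) ↦ K(ξ, h⁻¹ • q)` — no first countability, no sequences. -/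
def translFamily (K : C(X × Q, ℂ)) : C(G, C(X × Q, ℂ)) :=
  (K.comp ⟨fun p : G × (X × Q) => (p.2.1, p.1⁻¹ • p.2.2), by fun_prop⟩).curry

/-- (Ported verbatim from the HodgeCMPerL package; no docstring in the source.) -/
@[simp] theorem translFamily_apply (K : C(X × Q, ℂ)) (h : G) (p : X × Q) :
    translFamily K h p = K (p.1, h⁻¹ • p.2) := rfl

/-- (Ported verbatim from the HodgeCMPerL package; no docstring in the source.) -/
theorem continuous_translFamily (K : C(X × Q, ℂ)) : Continuous (translFamily (G := G) K) :=
  (translFamily K).continuous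

end Transl

end KernelOp
end HodgeCM

end
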